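import Mathlib
import HarnessLib
import Literature.Probability.LatticeModels.LatticeBootstrapFeasible
import Literature.Probability.LatticeModels.GriffithsMonotonicity
import Literature.Probability.LatticeModels.FreeBoundaryReflectionPositivity
import Literature.Probability.LatticeModels.LebowitzPropagation

/-!
# Route `LatticeSDPCertificates`, crux `CertifiedWindow` (stmt-CriticalPhenomena-5504):
# moment positivity of boundary-law functionals

The POSITIVITY rows of the law behind a level-`L` boundary-law functional
`E = boundaryLawFunctional d L β ν : A ↦ ∫ ⟨σ_A⟩^η_{Λ_L;β,0} dν(η)` (Cho–Sun 2023, Def. 11, the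
probability rows of the Gibbs-inside lattice Ising bootstrap): for every finite `D` and every
configuration `σ`,

  `0 ≤ ∑_{A ⊆ D} σ_A E(A)`.

Proof: the Walsh expansion `∑_{A ⊆ D} σ_A s_A = ∏_{x ∈ D} (1 + σ_x s_x)` has factors
`1 + σ_x s_x ∈ {0, 2}`, so the integrand is pointwise nonnegative; linearity of the finite-volume
Gibbs expectation (`isingExpect_sum_mul_spinProduct`) and of `∫ dν` (`integral_finsetSum`,
`integral_const_mul`; the integrands `η ↦ ⟨σ_A⟩^η_{Λ_L}` are measurable and bounded by `1`,
`integrable_isingCorr_fixed`) then give the sign of `∑_A σ_A ⟨σ_A⟩^η_{Λ_L}` for every `η` and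
of its `ν`-average.

* `sum_powerset_spinProduct_mul_spinProduct` — the Walsh expansion;
* `sum_powerset_spinProduct_mul_isingCorr_nonneg` — finite volume, any graph / volume / field /
  boundary condition;
* `sum_powerset_spinProduct_mul_boundaryLawFunctional_nonneg` — boundary-law mixtures, any `d`,
  `L`, `β`;
* `stub_momentPositivity` — the registered stub of the rev-4 skeleton of the crux, verbatim.

Helper file (`--supports stmt-CriticalPhenomena-5504`); nothing here proves or refutes the crux.
References: Cho–Sun 2023, Def. 11 [ChoSun2023] (the rows); Friedli–Velenik 2017, §3.6.1 and
§6.2 [FriedliVelenik2017]; the computation is elementary [folklore].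
-/

noncomputable section

namespace Summit.CriticalPhenomena.Ising3DConformalLimit.Theorems

open Literature.Probability.LatticeModels MeasureTheory Finset

/-- **Walsh expansion of a product.** `∑_{A ⊆ D} σ_A s_A = ∏_{x ∈ D} (1 + σ_x s_x)`
(`Finset.prod_one_add` and `σ_A s_A = ∏_{x ∈ A} σ_x s_x`). [folklore] -/
theorem sum_powerset_spinProduct_mul_spinProduct {V : Type*} (D : Finset V)
    (σ s : SpinConfig V) :
    ∑ A ∈ D.powerset, spinProduct A σ * spinProduct A s =
      ∏ x ∈ D, (1 + spinAt x σ * spinAt x s) := by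
  rw [Finset.prod_one_add]
  refine Finset.sum_congr rfl fun A _ => ?_
  rw [spinProduct, spinProduct, ← Finset.prod_mul_distrib]

/-- Each Walsh factor `1 + σ_x s_x` lies in `{0, 2}`, hence is nonnegative. [folklore] -/
theorem one_add_spinAt_mul_spinAt_nonneg {V : Type*} (x : V) (σ s : SpinConfig V) :
    0 ≤ 1 + spinAt x σ * spinAt x s := by
  rcases spinAt_eq_one_or_eq_neg_one x σ with h1 | h1 <;>
    rcases spinAt_eq_one_or_eq_neg_one x s with h2 | h2 <;>
    · rw [h1, h2]; norm_num

/-- Pointwise positivity of the Walsh kernel: `0 ≤ ∑_{A ⊆ D} σ_A s_A` for all configurations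
`σ, s`. [folklore] -/
theorem sum_powerset_spinProduct_mul_spinProduct_nonneg {V : Type*} (D : Finset V)
    (σ s : SpinConfig V) :
    0 ≤ ∑ A ∈ D.powerset, spinProduct A σ * spinProduct A s := by
  rw [sum_powerset_spinProduct_mul_spinProduct]
  exact Finset.prod_nonneg fun x _ => one_add_spinAt_mul_spinAt_nonneg x σ s

/-- **Moment positivity in finite volume.** For every finite-volume Gibbs measure
`μ^{bc}_{Λ;β,h}` of the nearest-neighbour Ising model on a locally finite graph, every finite `D`
and every configuration `σ`: `0 ≤ ∑_{A ⊆ D} σ_A ⟨σ_A⟩^{bc}_{Λ;β,h}` — the left-hand side is the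
expectation of the nonnegative observable `s ↦ ∑_{A ⊆ D} σ_A s_A = ∏_{x∈D}(1 + σ_x s_x)`
(the probability rows of Cho–Sun 2023, Def. 11). [folklore] -/
theorem sum_powerset_spinProduct_mul_isingCorr_nonneg {V : Type*} [DecidableEq V]
    (G : SimpleGraph V) [G.LocallyFinite] (Λ : Finset V) (β h : ℝ) (bc : BoundaryCondition V)
    (D : Finset V) (σ : SpinConfig V) :
    0 ≤ ∑ A ∈ D.powerset, spinProduct A σ * isingCorr G Λ β h bc A := by
  have key : isingExpect G Λ β h bc
      (fun s => ∑ A ∈ D.powerset, spinProduct A σ * spinProduct A s) =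
      ∑ A ∈ D.powerset, spinProduct A σ * isingCorr G Λ β h bc A :=
    isingExpect_sum_mul_spinProduct G D.powerset (fun A => spinProduct A σ) (fun A => A) Λ β h bc
  rw [← key]
  exact integral_nonneg fun s => sum_powerset_spinProduct_mul_spinProduct_nonneg D σ s

/-- A finite Walsh combination of a boundary-law functional is the `ν`-average of the same
combination of the fixed-boundary finite-volume correlations:
`∑_{A ⊆ D} σ_A E(A) = ∫ ∑_{A ⊆ D} σ_A ⟨σ_A⟩^η_{B(L)} dν(η)` (finite sums commute with `∫ dν`;
the integrands are measurable and bounded by `1`, `integrable_isingCorr_fixed`). [folklore] -/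
theorem sum_powerset_spinProduct_mul_boundaryLawFunctional_eq_integral {d : ℕ} (L : ℕ) (β : ℝ)
    (ν : Measure (SpinConfig (Site d))) [IsFiniteMeasure ν] (D : Finset (Site d))
    (σ : SpinConfig (Site d)) :
    ∑ A ∈ D.powerset, spinProduct A σ * boundaryLawFunctional d L β ν A =
      ∫ η, ∑ A ∈ D.powerset, spinProduct A σ *
        isingCorr (zdGraph d) (box d L) β 0 (.fixed η) A ∂ν := by
  rw [integral_finsetSum _ fun A _ =>
    (integrable_isingCorr_fixed (zdGraph d) ν (box d L) β 0 A).const_mul (spinProduct A σ)]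
  refine Finset.sum_congr rfl fun A _ => ?_
  rw [boundaryLawFunctional_apply, ← integral_const_mul]

/-- **Moment positivity of boundary-law functionals.** For every level `L`, every inverse
temperature `β`, every finite boundary law `ν`, every finite `D ⊆ ℤ^d` and every configuration
`σ`: `0 ≤ ∑_{A ⊆ D} σ_A E(A)` for `E = boundaryLawFunctional d L β ν` (integrate the
finite-volume statement `sum_powerset_spinProduct_mul_isingCorr_nonneg` over `η ∼ ν`; these are
the probability rows of Cho–Sun 2023, Def. 11, for the law `ν γ_{B(L)}`). [folklore] -/
theorem sum_powerset_spinProduct_mul_boundaryLawFunctional_nonneg {d : ℕ} (L : ℕ) (β : ℝ)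
    (ν : Measure (SpinConfig (Site d))) [IsFiniteMeasure ν] (D : Finset (Site d))
    (σ : SpinConfig (Site d)) :
    0 ≤ ∑ A ∈ D.powerset, spinProduct A σ * boundaryLawFunctional d L β ν A := by
  rw [sum_powerset_spinProduct_mul_boundaryLawFunctional_eq_integral L β ν D σ]
  exact integral_nonneg fun η =>
    sum_powerset_spinProduct_mul_isingCorr_nonneg (zdGraph d) (box d L) β 0 (.fixed η) D σ

/-- **Registered stub `stub_momentPositivity` of the rev-4 skeleton of crux `CertifiedWindow`
(line `registered` = `Cruxes/CertifiedWindow/Lines/birth.lean`)**, verbatim the registered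
signature: positivity of the law behind a level-`L` boundary-law functional at `d = 3`,
`β = β_c(3)` — `0 ≤ ∑_{A ⊆ D} σ_A E(A)` for every probability boundary law `ν`, every finite `D`
and every `σ`. [folklore] -/
theorem stub_momentPositivity : ∀ (L : ℕ) (ν : MeasureTheory.Measure (Literature.Probability.LatticeModels.SpinConfig (Literature.Probability.LatticeModels.Site 3))), MeasureTheory.IsProbabilityMeasure ν → ∀ (D : Finset (Literature.Probability.LatticeModels.Site 3)) (σ : Literature.Probability.LatticeModels.SpinConfig (Literature.Probability.LatticeModels.Site 3)), 0 ≤ ∑ A ∈ D.powerset, Literature.Probability.LatticeModels.spinProduct A σ * Literature.Probability.LatticeModels.boundaryLawFunctional 3 L (Literature.Probability.LatticeModels.criticalBeta 3) ν A :=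
  fun L ν _ D σ =>
    sum_powerset_spinProduct_mul_boundaryLawFunctional_nonneg L (criticalBeta 3) ν D σ

end Summit.CriticalPhenomena.Ising3DConformalLimit.Theorems
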